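import Summits.MatrixMultiplication.OmegaCensus.SmallFormats.MatMul22nRankGF5XCapWlogWords
import HarnessLib

/-!
# ω-census family (a): the X-cap system over `𝔽₅` with ONE pivot (rows `< 469`) as a `BoxCert.System`, fed by the word-WLOG

Cell `pub-omega` (unit `pub-omega-tensor-g11`), topic `Summits/MatrixMultiplication/OmegaCensus` (sub-folder `SmallFormats`).
Framing (verbatim): lottery ticket; floor = certified bounds/negative ranges. HONEST FRAMING: bookkeeping, no bound on a rank, not
progress on `ω`. `xcapSys5w1 s` = the columns of `xcapSys5` with the entries of the second-pivot WLOG rows `469 … 497` filtered out,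
`M = 469`: the 350 cap / row-plane rows at slack `s` plus the 119 rows `x_g − x_32 ≤ 0` (invertible `g ≠ 32`). `feasible_w1_of_rows350`:
a class-count vector with the 350 rows and its invertible maximum at the identity class (as produced by `exists_wlog_argmax5`,
`MatMul22nRankGF5XCapWlogWords`) is `Feasible` for `xcapSys5w1 s`, so `BoxCert` / `CertP` / `CertQ` certificates can be checked against
it inside the symmetric statement `NoTightPoint5` (`MatMul22nRankGF5ThreeNPlusFiveReduction`) — step (b) of the successor blueprint
`pub-omega-tensor-g11/METHOD-PARITY-g11.md` §3.
-/

namespace Summit.MatrixMultiplication.OmegaCensus.SmallFormats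

open Finset

/-- Columns of `xcapSys5` restricted to the rows `< 469` (cap rows, row planes, first-pivot WLOG rows). -/
def col5w1 (j : ℕ) : List (ℕ × ℤ) := (col5 j).filter fun e => e.1 < 469

/-- The one-pivot X-cap system at slack `s`. -/
def xcapSys5w1 (s : ℕ) : BoxCert.System := ⟨157, 469, col5w1, rhs5s s⟩

/-- Column well-formedness (by construction of the filter). -/
theorem xcapSys5w1_colWF (s : ℕ) : (xcapSys5w1 s).ColWF := by
  intro j e he
  change e ∈ (col5 j).filter (fun e => e.1 < 469) at he
  exact (List.mem_filter.1 he).2 |> of_decide_eq_true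

/-- Below row `469` the coefficients agree with `xcapSys5s`. -/
theorem xcapSys5w1_A {s : ℕ} {r : ℕ} (hr : r < 469) (j : ℕ) : (xcapSys5w1 s).A r j = (xcapSys5s s).A r j := by
  change ((col5w1 j).filter (fun e => e.1 = r)).foldr (fun e acc => e.2 + acc) 0
    = ((col5 j).filter (fun e => e.1 = r)).foldr (fun e acc => e.2 + acc) 0
  unfold col5w1
  rw [List.filter_filter]
  congr 1
  apply List.filter_congr
  intro e _
  by_cases h : e.1 = r
  · simp [h, hr]
  · simp [h]

set_option maxRecDepth 100000 in
/-- The first-pivot WLOG rows `350 … 468` are `x_{symVar5 r} − x_32 ≤ 0` with `symVar5 r` an invertible class. -/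
theorem symVar5_mem_invList5 : ∀ r : Fin 469, 350 ≤ r.val → symVar5 r.val ∈ invList5 ∧ symPivot5 r.val = 32 := by decide +kernel

/-- **Feeding the one-pivot system.** The 350 cap / row-plane rows plus "the identity class carries the maximum over the invertible
classes" give `Feasible` for `xcapSys5w1 s`. -/
theorem feasible_w1_of_rows350 {s : ℕ} {x : ℕ → ℕ} (h350 : ∀ r < 350, rowVal5 s x r ≤ rhs5s s r)
    (hmax : ∀ g ∈ invList5, x g ≤ x 32) : (xcapSys5w1 s).Feasible x := by
  intro r hr
  change r < 469 at hr
  show ∑ j ∈ range 157, (xcapSys5w1 s).A r j * (x j : ℤ) ≤ rhs5s s r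
  have eA : ∀ j ∈ range 157, (xcapSys5w1 s).A r j * (x j : ℤ) = (xcapSys5s s).A r j * (x j : ℤ) := by
    intro j _; rw [xcapSys5w1_A hr]
  rw [sum_congr rfl eA]
  by_cases hr350 : r < 350
  · exact h350 r hr350
  · -- a first-pivot WLOG row
    have h350' : 350 ≤ r := not_lt.1 hr350
    have eS : ∀ j ∈ range 157, (xcapSys5s s).A r j * (x j : ℤ)
        = (if j = symVar5 r then (x j : ℤ) else 0) - (if j = symPivot5 r then (x j : ℤ) else 0) := by
      intro j hj
      rw [xcapSys5s_A, xcapSys5_A_eq' (by omega) (mem_range.1 hj), rowCoef5_sym' (by omega) h350' (mem_range.1 hj)]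
      split_ifs <;> simp
    rw [sum_congr rfl eS, sum_sub_distrib, sum_ite_eq' (range 157), sum_ite_eq' (range 157)]
    obtain ⟨hmem, hpiv⟩ := symVar5_mem_invList5 ⟨r, hr⟩ h350'
    have hs := symVar5_lt' (show r < 498 by omega) h350'
    rw [if_pos (mem_range.2 (by omega)), hpiv, if_pos (mem_range.2 (by norm_num))]
    have : rhs5s s r = 0 := by simp [rhs5s]; omega
    rw [this]
    have hle : (x (symVar5 r) : ℤ) ≤ (x 32 : ℤ) := by exact_mod_cast hmax _ hmem
    linarith

end Summit.MatrixMultiplication.OmegaCensus.SmallFormats
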